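import Mathlib
import Summits.Ventures.HodgeRepro.Tier4.Line4.L1ClassV3

/-!
# Tier4/Line4/SublevelCount — display (8)'s input: the sublevel lattice count in the `archDist` vocabulary

Blind re-derivation cell `pub-hodge-repro`, Tier 4 «prove the step» (README §9–§10), seat t4-L4-p2 (prover, LINE L4,
gen 4; cut C-L4-SUBLEVEL, plan-4 g4 S14955 (K1), shape = t4-x2 g4's `hcount` binder S14945 with `dinf := archDist W`,
S14965).  Tree path `lean/Summits/Ventures/HodgeRepro/Tier4/Line4/SublevelCount.lean`.  A DISPLAY (one `def … : Prop`),
no proof of it is claimed.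

`SublevelCount W S`: for every compact `Kf` of the finite part `G(𝔸_f)` and every pair of compacts `C₁ C₂ ⊆ G(𝔸)` there are
`C′ ≥ 0` and an exponent `α < 3` such that, uniformly for `x ∈ C₁`, `y ∈ C₂`, the rational points `γ` with
`(x⁻¹ γ y)_f ∈ Kf` and `archDist (x⁻¹ γ y) ≤ T` number at most `C′ e^{αT}` — stated with an explicit finite set `s`
containing them (no `ncard` junk).  This is the hyperbolic lattice-point count per indefinite real place (`e^{2T}` on
`U(1,1)`, `T^{r−1} e^{2T}` convolved along the sum over the places, `L1ClassV3` §(A)(ii)) and is the one clause of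
display (8) `PoincareOfDecay` with no tree theorem: `t4-x2`'s `poincareSummable_of_decay` turns it, together with
`HasDecay3`, into `PoincareSummable S (prodFn W finf ffin)`.  Reduction available on the tree: by `LatticeVolume`
(`card_mul_measure_le_of_separating`) the count is at most `μ(K_T · U)/μ(U)` for the sublevel set
`K_T = {g : g_f ∈ Kf ∧ archDist g ≤ T}` (translated by the compacts), so the display follows from a VOLUME bound
`μ(K_T) ≤ C e^{αT}` on the Haar measure of `G(𝔸)` once the local model of `U(W)(k_w)` at the real places is in the tree.
`archDist` is `G(k)`-invariant on neither side (it is a size, not a distance on the quotient) — the count is on the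
translate, as the Poincaré series needs.

Nothing here says anything about the status of the Hodge conjecture for CM abelian varieties, which is NOT proved
(HC_CM is NOT proved by anyone in this repository).
-/

set_option autoImplicit false

noncomputable section

namespace Summit.Ventures.HodgeRepro.Tier4.Line4

open Summit.Ventures.HodgeRepro.Tier4.Common Summit.Ventures.HodgeRepro.Tier4.Line1
  Summit.Ventures.HodgeRepro.Tier4.Line1.RTF Summit.Ventures.HodgeRepro.Tier4.Line4.L1Class MeasureTheory NumberField

variable {k : Type} [Field k] [NumberField k] (W : PlaneData k) [MeasurableSpace (GA W)] [BorelSpace (GA W)]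

omit [MeasurableSpace (GA W)] [BorelSpace (GA W)] in
/-- **DISPLAY — the sublevel lattice count** (the `hcount` binder of `poincareSummable_of_decay`, `dinf := archDist W`): on
every compact `Kf ⊆ G(𝔸_f)` and compacts `C₁ C₂ ⊆ G(𝔸)`, the rational points `γ` with `(x⁻¹ γ y)_f ∈ Kf` and
`archDist (x⁻¹ γ y) ≤ T` lie in a finite set of at most `C′ e^{αT}` elements, `α < 3`, uniformly in `x ∈ C₁`, `y ∈ C₂`. -/
def SublevelCount (S : RTF.Setting (GA W)) : Prop :=
  ∀ Kf : Set (GA W), IsCompact Kf → Kf ⊆ (finitePart W : Set (GA W)) →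
    ∀ C₁ C₂ : Set (GA W), IsCompact C₁ → IsCompact C₂ →
      ∃ C' α : ℝ, 0 ≤ C' ∧ α < 3 ∧ ∀ x ∈ C₁, ∀ y ∈ C₂, ∀ T : ℝ, ∃ s : Finset S.Gk,
        (∀ γ : S.Gk, GA.ofFinPart W (x⁻¹ * γ * y) ∈ Kf → archDist W (x⁻¹ * γ * y) ≤ T → γ ∈ s) ∧
        (s.card : ℝ) ≤ C' * Real.exp (α * T)

end Summit.Ventures.HodgeRepro.Tier4.Line4

end
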